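import Summits.BirchSwinnertonDyer.BirchSwinnertonDyer.Theorems.PrintCf2RamifiedOffTYZEvenOmegaDictionaryChains
import Summits.BirchSwinnertonDyer.Rank1Residual.P2.CongruentNumberOddAokiMonskySymbols
import HarnessLib

/-!
# Route `PrintCf2`, crux stmt-BirchSwinnertonDyer-20509 `RamifiedOffTYZOfFacts` — THE EVEN Ω-IDENTITY: DICTIONARY, III (the summands of the two forms)
# (cell `bsd-print-cf2`, LEAD of 20509 g14, line `offtyz-v7`, cycle 15; kernel helpers `--supports stmt-BirchSwinnertonDyer-20509`)

Third part of the census ↔ forest dictionary (`Lines/offtyz_v7_EvenOmegaProof.md` §1): the SUMMANDS of LEAD g13's `evenSquareFormMatrix` (census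
coordinates) and of `evenOmegaFormMatrix` (adjugate of Monsky's even matrix) as the summands / values of the abstract forest quantities of the row
identities `row_two_identity`, `row_three_identity`, `row_four_identity`.  Throughout `p` is a tuple of distinct odd primes with `∏ pᵢ ≡ 3 (mod 4)`
where needed, `a i j = legendreMatrix p i j`, `t = ((−1/pᵢ)₊)`, `z = ((2/pᵢ)₊)`:
* §1 `[d_{Sᶜ} ≡ 1 (8)]·blockWeightOdd p Sᶜ = (Σ_S t)·blockWeightOdd p Sᶜ` (parity theorem + `Σ t = 1`); the even summand with `κ^S_r`
  (`= (Σ_S t)·((p_{e_r} q_z) ⋆ setExp(q_{t+z}))(S)·W′(Sᶜ)`), with `κ^S_j + κ^S_∞` (the Cramer determinant of (★)₆), and the odd summand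
  (`[d_T ≡ 5]·chainCoeff·blockRho_r = (Σ_T z)·(q_{e_r} ⋆ Y)(T)·(f_o ⋆ F)(Tᶜ)`);
* §2 the adjugate sums `Σ_j x_j A_j = ((p_t q_x) ⋆ F)(univ)`, `Σ_j x_j A′_j = ((p_x q_z) ⋆ F)(univ)`, `Σ_j t_j A_j = (Y ⋆ F)(univ)`.
Pure linear algebra over `𝔽₂` + quadratic reciprocity; no `sorry`.  BSD is not proved by any of this; no class is closed.

References: [cite: HeathBrown1994SelmerCongruentII, Appendix (Monsky), typescript p. 39 L10 – p. 41 L36]; [cite: Chaiken1982, §2]; [cite: Stanley1999EC2, Cor. 5.1.6];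
[cite: TianYuanZhang2017, Thm. 1.1, Thm. 3.6 (2)]; crux notes `Lines/offtyz_v7_EvenOmegaProof.md` §1.
-/

noncomputable section

open scoped Classical

namespace Summit.BirchSwinnertonDyer.PrintCf2.QFormForest

open Matrix Finset Literature.LinearAlgebra.Matrix Literature.Combinatorics.Enumerative
open Literature.NumberTheory.EllipticCurves.Smith2016
open Literature.NumberTheory.EllipticCurves.HeathBrown1994 Literature.NumberTheory.EllipticCurves.HeathBrown1994.Families
open Literature.NumberTheory.EllipticCurves.MonskySelmerParity
open Summit.BirchSwinnertonDyer.PrintCf2.QForm Summit.BirchSwinnertonDyer.PrintCf2.EvenOmegaDefs Summit.BirchSwinnertonDyer.PrintCf2.MoverAssembly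

set_option autoImplicit false

section Abstract

variable {V : Type*} [Fintype V] [LinearOrder V]

/-- `((p_{e_r} q_v) ⋆ setExp(q_ℓ))(S) = [r ∈ S]·det((L_S + D_ℓ)[col r ← v·1_S])` (Cramer's column against the forest cofactors).
[cite: Chaiken1982, §2] [cite: HornJohnson2013, §0.8.2] -/
theorem sconv_spoint_single_qwt_setExp_eq (a : V → V → ZMod 2) (ℓ v : V → ZMod 2) (S : Finset V) (r : V) :
    sconv (spoint (Pi.single r 1) (qwt a v)) (setExp (qwt a ℓ)) S =
      if r ∈ S then ((lap a S ℓ).updateCol r (fun x => if x ∈ S then v x else 0)).det else 0 := by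
  rw [sconv_apply]
  have h : ∀ C ∈ S.powerset, spoint (Pi.single r 1) (qwt a v) C * setExp (qwt a ℓ) (S \ C) =
      if r ∈ C then qwt a v C * setExp (qwt a ℓ) (S \ C) else 0 := by
    intro C _; rw [spoint_apply, sum_pi_single']; split_ifs <;> simp
  rw [sum_congr rfl h, ← sum_filter]
  by_cases hr : r ∈ S
  · rw [if_pos hr, det_updateCol_lap_eq_sum_qwt a ℓ v hr, sum_powerset_filter_mem_eq _ hr]
    exact sum_congr rfl fun C₀ _ => by rw [erase_sdiff_eq_sdiff_insert]
  · rw [if_neg hr]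
    refine sum_eq_zero fun C hC => ?_
    exact absurd ((mem_powerset.mp (mem_filter.mp hC).1) (mem_filter.mp hC).2) hr

/-- `(q_{e_r} ⋆ Y)(T) = 0` for `r ∉ T`. [cite: Chaiken1982, §2] -/
theorem sconv_qwt_single_eq_zero_of_not_mem (a : V → V → ZMod 2) (g : Finset V → ZMod 2) {T : Finset V} {r : V} (hr : r ∉ T) :
    sconv (qwt a (Pi.single r 1)) g T = 0 := by
  refine sconv_eq_zero_of fun C hC => ?_
  rw [qwt_single, if_neg (fun h => hr (hC h)), zero_mul]

end Abstract

section Dictionary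

variable {k : ℕ} (p : Fin k → ℕ) (hp : ∀ i, (p i).Prime) (hodd : ∀ i, Odd (p i)) (hinj : Function.Injective p)

/-! ## §1 The summands of the even square form -/

include hp hodd hinj in
/-- **`[d_{Sᶜ} ≡ 1 (8)]·det M_{d_{Sᶜ}} = (Σ_S t)·det M_{d_{Sᶜ}}`** for `∏ pᵢ ≡ 3 (mod 4)`: `d_{Sᶜ} ≡ 1 (8)` iff `(Σ_{Sᶜ} t, Σ_{Sᶜ} z) = (0,0)`;
`Σ_{Sᶜ} t = 0` iff `Σ_S t = 1`; and when `Σ_{Sᶜ} t = 0 ≠ Σ_{Sᶜ} z` the co-block weight vanishes (parity theorem).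
[cite: HeathBrown1994SelmerCongruentII, Appendix (Monsky), typescript p. 40 L1–L31] [cite: Chaiken1982, §2] -/
theorem ite_blockWeightOdd_compl_eq (h3 : (∏ i, p i) % 4 = 3) (S : Finset (Fin k)) :
    (if (∏ i ∈ Sᶜ, p i) % 8 = 1 then blockWeightOdd p Sᶜ else 0) = (∑ i ∈ S, addLegendreSym (-1) (p i)) * blockWeightOdd p Sᶜ := by
  have hp2 : ∀ i, p i ≠ 2 := ne_two_of_odd p hodd
  have hrec : ∀ i j : Fin k, i ≠ j → legendreMatrix p i j + legendreMatrix p j i = addLegendreSym (-1) (p i) * addLegendreSym (-1) (p j) :=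
    fun i j hij => hrec_legendre p hp hp2 hinj i (mem_univ i) j (mem_univ j) hij
  have hres := (prod_mod_eight_iff_sums p hp hodd Sᶜ).1
  have hsplit : ∑ i ∈ S, addLegendreSym (-1) (p i) + ∑ i ∈ Sᶜ, addLegendreSym (-1) (p i) = 1 := by
    rw [sum_add_sum_compl]; exact Summit.BirchSwinnertonDyer.Rank1Residual.P2.AokiMonsky.sum_eps_eq_one_of_prod_mod_four p hodd h3
  have h01 : ∀ u : ZMod 2, u = 0 ∨ u = 1 := by decide
  rcases h01 (∑ i ∈ Sᶜ, addLegendreSym (-1) (p i)) with hc0 | hc1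
  · have hS1 : ∑ i ∈ S, addLegendreSym (-1) (p i) = 1 := by
      have e : ∀ u : ZMod 2, u + 0 = 1 → u = 1 := by decide
      exact e _ (hc0 ▸ hsplit)
    rw [hS1, one_mul]
    rcases h01 (∑ i ∈ Sᶜ, addLegendreSym 2 (p i)) with hz0 | hz1
    · rw [if_pos (hres.mpr ⟨hc0, hz0⟩)]
    · rw [if_neg (fun h => zero_ne_one ((hres.mp h).2.symm.trans hz1)), blockWeightOdd_eq_det_bigN p hp hodd hinj, det_bigN_eq_setExp,
        setExp_fwt_zero_root_eq_zero_of_ne _ _ _ hrec (by rw [hc0, hz1]; exact zero_ne_one)]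
  · have hS0 : ∑ i ∈ S, addLegendreSym (-1) (p i) = 0 := by
      have e : ∀ u : ZMod 2, u + 1 = 1 → u = 0 := by decide
      exact e _ (hc1 ▸ hsplit)
    rw [hS0, zero_mul, if_neg (fun h => zero_ne_one ((hres.mp h).1.symm.trans hc1))]

include hp hodd hinj in
/-- **The even summand of the `x_im x_r`-row**: `[d_{Sᶜ} ≡ 1]·blockWeightOdd p Sᶜ·blockKappaSix p S r = (Σ_S t)·((p_{e_r} q_z) ⋆ setExp(q_{t+z}))(S)·W′(Sᶜ)`
(`W′(Sᶜ) = setExp(fwt a t z 0)(Sᶜ)`). [cite: HeathBrown1994SelmerCongruentII, Appendix (Monsky), typescript p. 41 L20–L36] [cite: Chaiken1982, §2] -/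
theorem even_summand_eq (h3 : (∏ i, p i) % 4 = 3) (S : Finset (Fin k)) (r : Fin k) :
    (if (∏ i ∈ Sᶜ, p i) % 8 = 1 then blockWeightOdd p Sᶜ * blockKappaSix p S r else 0) =
      (∑ i ∈ S, addLegendreSym (-1) (p i)) *
        sconv (spoint (Pi.single r 1) (qwt (fun i j => legendreMatrix p i j) (fun i => addLegendreSym 2 (p i))))
          (setExp (qwt (fun i j => legendreMatrix p i j) (fun i => addLegendreSym (-1) (p i) + addLegendreSym 2 (p i)))) S *
        setExp (fwt (fun i j => legendreMatrix p i j) (fun i => addLegendreSym (-1) (p i)) (fun i => addLegendreSym 2 (p i)) 0) Sᶜ := by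
  have hw := ite_blockWeightOdd_compl_eq p hp hodd hinj h3 S
  rw [sconv_spoint_single_qwt_setExp_eq, ← blockKappaSix_eq_det_updateCol p hp hodd S r, ← det_bigN_eq_setExp,
    ← blockWeightOdd_eq_det_bigN p hp hodd hinj]
  by_cases hc : (∏ i ∈ Sᶜ, p i) % 8 = 1
  · rw [if_pos hc] at hw ⊢; rw [mul_right_comm, ← hw]
  · rw [if_neg hc] at hw ⊢; rw [mul_right_comm, ← hw, zero_mul]

include hp hodd in
/-- **The even summand of the `x_2 x_r`-row**: for `r ∈ S`, `blockKappaSix p S r + blockKappaSixInf p S = det((lap a S (t+z))[col r ← t·1_S])` —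
the regime-free kernel line (LEAD g13 `kerSum_six_inl_add_inr_all`) in ambient coordinates (the Cramer determinant of (★)₆).
[cite: HeathBrown1994SelmerCongruentII, Appendix (Monsky), typescript p. 41 L20–L36] [cite: HornJohnson2013, §0.8.2] -/
theorem blockKappaSix_add_inf_eq {S : Finset (Fin k)} {r : Fin k} (hr : r ∈ S) :
    blockKappaSix p S r + blockKappaSixInf p S =
      ((lap (fun i j => legendreMatrix p i j) S (fun j => addLegendreSym (-1) (p j) + addLegendreSym 2 (p j))).updateCol r
        (fun x => if x ∈ S then addLegendreSym (-1) (p x) else 0)).det := by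
  have hp2 : ∀ i, p i ≠ 2 := ne_two_of_odd p hodd
  set q : Fin S.card → ℕ := blockPrimes p S with hq
  have hqp : ∀ j, (q j).Prime := fun j => hp _
  have hqo : ∀ j, Odd (q j) := fun j => hodd _
  rw [blockKappaSix, dif_pos hr, blockKappaSixInf, blockSixMatrix, ← hq, kerSum_six_inl_add_inr_all q hqp hqo,
    det_updateCol_lap_eq_det_updateCol_block p hp hp2 hr]
  rfl

include hp hodd hinj in
/-- **The odd summand of the `x_im x_r`-row**: `[d_T ≡ 5 (8)]·chainCoeff p T·blockRho p T r = (Σ_T z)·(q_{e_r} ⋆ Y)(T)·(f_o ⋆ F)(Tᶜ)` for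
`∏ pᵢ ≡ 3 (mod 4)` (blocks with `Σ_T t = 1` contribute nothing on either side: `(f_o ⋆ F)` lives on odd sets and `Tᶜ` is then even).
[cite: TianYuanZhang2017, Thm. 1.1, Thm. 3.6 (2)] [cite: HeathBrown1994SelmerCongruentII, Appendix (Monsky), typescript p. 39 L13–L41] [cite: Chaiken1982, §2] -/
theorem odd_summand_eq (h3 : (∏ i, p i) % 4 = 3) (T : Finset (Fin k)) (r : Fin k) :
    (if (∏ i ∈ T, p i) % 8 = 5 then chainCoeff p T * blockRho p T r else 0) =
      (∑ i ∈ T, addLegendreSym 2 (p i)) *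
        sconv (qwt (fun i j => legendreMatrix p i j) (Pi.single r 1)) (setExp (qwt (fun i j => legendreMatrix p i j) (fun i => addLegendreSym (-1) (p i)))) T *
        sconv (fwt (fun i j => legendreMatrix p i j) (fun i => addLegendreSym (-1) (p i)) (fun i => addLegendreSym 2 (p i)) 0)
          (setExp (fwt (fun i j => legendreMatrix p i j) (fun i => addLegendreSym (-1) (p i)) (fun i => addLegendreSym 2 (p i))
            (fun i => addLegendreSym 2 (p i)))) Tᶜ := by
  have hp2 : ∀ i, p i ≠ 2 := ne_two_of_odd p hodd
  have hrec : ∀ i j : Fin k, i ≠ j → legendreMatrix p i j + legendreMatrix p j i = addLegendreSym (-1) (p i) * addLegendreSym (-1) (p j) :=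
    fun i j hij => hrec_legendre p hp hp2 hinj i (mem_univ i) j (mem_univ j) hij
  have hres := (prod_mod_eight_iff_sums p hp hodd T).2.2.1
  have h01 : ∀ u : ZMod 2, u = 0 ∨ u = 1 := by decide
  rcases h01 (∑ i ∈ T, addLegendreSym (-1) (p i)) with hT0 | hT1
  · rw [blockRho_eq_sconv p hp hodd hinj T hT0 r]
    rcases h01 (∑ i ∈ T, addLegendreSym 2 (p i)) with hz0 | hz1
    · rw [hz0, zero_mul, zero_mul, if_neg (fun h => zero_ne_one (hz0.symm.trans (hres.mp h).2))]
    · rw [if_pos (hres.mpr ⟨hT0, hz1⟩), hz1, one_mul, chainCoeff_eq_sconv p hp hodd hinj (hres.mpr ⟨hT0, hz1⟩)]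
      by_cases hr : r ∈ T
      · rw [if_pos hr, mul_comm]
      · rw [if_neg hr, mul_zero, sconv_qwt_single_eq_zero_of_not_mem _ _ hr, zero_mul]
  · -- `Σ_T t = 1`: the block is not `≡ 5 (8)` and `(f_o ⋆ F)(Tᶜ)` vanishes (`Tᶜ` is even)
    rw [if_neg (fun h => zero_ne_one ((hres.mp h).1.symm.trans hT1))]
    have hsplit : ∑ i ∈ T, addLegendreSym (-1) (p i) + ∑ i ∈ Tᶜ, addLegendreSym (-1) (p i) = 1 := by
      rw [sum_add_sum_compl]; exact Summit.BirchSwinnertonDyer.Rank1Residual.P2.AokiMonsky.sum_eps_eq_one_of_prod_mod_four p hodd h3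
    have hc0 : ∑ i ∈ Tᶜ, addLegendreSym (-1) (p i) = 0 := by
      have e : ∀ u : ZMod 2, 1 + u = 1 → u = 0 := by decide
      exact e _ (hT1 ▸ hsplit)
    have hpar := sconv_support_parity (fun i => addLegendreSym (-1) (p i))
      (fwt_zero_root_support_odd (fun i j => legendreMatrix p i j) (fun i => addLegendreSym (-1) (p i)) (fun i => addLegendreSym 2 (p i)))
      (setExp_fwt_self_support_even (fun i j => legendreMatrix p i j) (fun i => addLegendreSym (-1) (p i)) (fun i => addLegendreSym 2 (p i))
        hrec) Tᶜ
    by_cases hG : sconv (fwt (fun i j => legendreMatrix p i j) (fun i => addLegendreSym (-1) (p i)) (fun i => addLegendreSym 2 (p i)) 0)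
        (setExp (fwt (fun i j => legendreMatrix p i j) (fun i => addLegendreSym (-1) (p i)) (fun i => addLegendreSym 2 (p i))
          (fun i => addLegendreSym 2 (p i)))) Tᶜ = 0
    · rw [hG, mul_zero]
    · have h := hpar hG
      rw [hc0] at h
      exact absurd h (by decide)

/-! ## §2 The adjugate sums of Monsky's even matrix -/

/-- **`Σ_j x_j A_j = ((p_t q_x) ⋆ F)(univ)`** (`A_j = adj(M_even)_{(inl j)(inr j)}`; column swap + rooted pointed forest sum).
[cite: HeathBrown1994SelmerCongruentII, Appendix (Monsky), typescript p. 41 L20–L36] [cite: Chaiken1982, §2] -/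
theorem sum_mul_adjugate_monskyEven_inl_inr (x : Fin k → ZMod 2) :
    ∑ j, x j * (monskyMatrixEven p).adjugate (Sum.inl j) (Sum.inr j) =
      sconv (spoint (fun i => addLegendreSym (-1) (p i)) (qwt (fun i j => legendreMatrix p i j) x))
        (setExp (fwt (fun i j => legendreMatrix p i j) (fun i => addLegendreSym (-1) (p i)) (fun i => addLegendreSym 2 (p i))
          (fun i => addLegendreSym 2 (p i)))) univ := by
  have h : ∀ j ∈ (univ : Finset (Fin k)), x j * (monskyMatrixEven p).adjugate (Sum.inl j) (Sum.inr j) =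
      x j * (bigN (fun i j => legendreMatrix p i j) univ (fun i => addLegendreSym (-1) (p i)) (fun i => addLegendreSym 2 (p i))
        (fun i => addLegendreSym 2 (p i))).adjugate (Sum.inr j) (Sum.inr j) := by
    intro j _; rw [adjugate_monskyMatrixEven_inl_inr]
  rw [sum_congr rfl h, sum_mul_adjugate_bigN_inr, sconv_apply]
  exact sum_congr rfl fun B _ => by rw [spoint_apply]

/-- **`Σ_j x_j A′_j = ((p_x q_z) ⋆ F)(univ)`** (`A′_j = adj(M_even)_{(inr j)(inl j)}`; column swap + pointed forest sum).
[cite: HeathBrown1994SelmerCongruentII, Appendix (Monsky), typescript p. 41 L20–L36] [cite: Chaiken1982, §2] -/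
theorem sum_mul_adjugate_monskyEven_inr_inl (x : Fin k → ZMod 2) :
    ∑ j, x j * (monskyMatrixEven p).adjugate (Sum.inr j) (Sum.inl j) =
      sconv (spoint x (qwt (fun i j => legendreMatrix p i j) (fun i => addLegendreSym 2 (p i))))
        (setExp (fwt (fun i j => legendreMatrix p i j) (fun i => addLegendreSym (-1) (p i)) (fun i => addLegendreSym 2 (p i))
          (fun i => addLegendreSym 2 (p i)))) univ := by
  have h : ∀ j ∈ (univ : Finset (Fin k)), x j * (monskyMatrixEven p).adjugate (Sum.inr j) (Sum.inl j) =
      x j * (bigN (fun i j => legendreMatrix p i j) univ (fun i => addLegendreSym (-1) (p i)) (fun i => addLegendreSym 2 (p i))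
        (fun i => addLegendreSym 2 (p i))).adjugate (Sum.inl j) (Sum.inl j) := by
    intro j _; rw [adjugate_monskyMatrixEven_inr_inl]
  rw [sum_congr rfl h, sum_mul_adjugate_bigN_inl, sconv_apply]
  exact sum_congr rfl fun B _ => by rw [spoint_apply]

include hp hodd hinj in
/-- **`G = Σ_j t_j A_j = (Y ⋆ F)(univ)`** for `∏ pᵢ ≡ 3 (mod 4)` (`Y = p_t q_t + δ` by the reciprocity lemma, and `F(univ) = 0` on the odd set `univ`).
[cite: Smith2016CongruentDensity, §2.2 case 5(b)] [cite: Chaiken1982, §2] -/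
theorem sum_neg_one_mul_adjugate_monskyEven_eq (h3 : (∏ i, p i) % 4 = 3) :
    ∑ j, addLegendreSym (-1) (p j) * (monskyMatrixEven p).adjugate (Sum.inl j) (Sum.inr j) =
      sconv (setExp (qwt (fun i j => legendreMatrix p i j) (fun i => addLegendreSym (-1) (p i))))
        (setExp (fwt (fun i j => legendreMatrix p i j) (fun i => addLegendreSym (-1) (p i)) (fun i => addLegendreSym 2 (p i))
          (fun i => addLegendreSym 2 (p i)))) univ := by
  have hp2 : ∀ i, p i ≠ 2 := ne_two_of_odd p hodd
  have hrec : ∀ i j : Fin k, i ≠ j → legendreMatrix p i j + legendreMatrix p j i = addLegendreSym (-1) (p i) * addLegendreSym (-1) (p j) :=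
    fun i j hij => hrec_legendre p hp hp2 hinj i (mem_univ i) j (mem_univ j) hij
  have hY : setExp (qwt (fun i j => legendreMatrix p i j) (fun i => addLegendreSym (-1) (p i))) =
      spoint (fun i => addLegendreSym (-1) (p i)) (qwt (fun i j => legendreMatrix p i j) (fun i => addLegendreSym (-1) (p i))) + sdelta := by
    rw [← spoint_setExp_qwt_eq _ _ hrec, spoint_setExp_qwt_self _ _ hrec, add_assoc, add_self_weight, add_zero]
  rw [sum_mul_adjugate_monskyEven_inl_inr p, hY, sconv_add_left, sdelta_sconv, Pi.add_apply,
    setExp_fwt_self_eq_zero_of_odd _ _ _ hrec (Summit.BirchSwinnertonDyer.Rank1Residual.P2.AokiMonsky.sum_eps_eq_one_of_prod_mod_four p hodd h3), add_zero]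

end Dictionary

end Summit.BirchSwinnertonDyer.PrintCf2.QFormForest

end
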